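import Mathlib
import HarnessLib
import HarnessLib.Audit
import Summits.QuantumFields.Statement
import Summits.QuantumFields.YangMills.Theses.CoincidenceRotationBootstrap
import Literature.MathematicalPhysics.QuantumLattice.EuclideanAction
import HarnessLib.Audit.Status.Attr

/-!
Route: ScalingWindowSplit

DORMANT since 2026-08-31T15:28:23Z (re-park after R688 (3′) (director-ym g23 O4 WORD 18 (1); 0 seats)) — unstaffed, not closed; items shared with open routes are served there. `ledger route dormant <id> --off` reactivates.

# Route ScalingWindowSplit — The existence leg from three lattice inequalities — gap at the
correlation length, self-normalised moment bounds, skewness floor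

DECOMPOSITION-FIRST (lens 3.4, cycle 2) on the summit's open core: X₀ =
`CoincidenceRotationBootstrap.HypercubicLimit` (stmt-QuantumFields-16154 =
MirrorModularBoosts / PencilRigidity / CertificationLength / IsotropyFromPowerCounting's
`WeakCouplingHypercubicLimit`: Yang–Mills minus the rotation half of
E1, the existence leg every E1 route imports and the judge's "open core, untouched") is SPLIT along
the RENORMALISATION SEAM into three LATTICE inequalities
for Wilson's theory at weak coupling, none of which mentions a continuum object, and the implication
W₁ → W₂ᴳ → U_R → X₀ is PROVED (support
ExistenceLegFromLatticeGapped — rev 8: the split re-pointed at the REPAIRED W₂ᴳ (and, since rev 6,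
at the repaired U_R), kernel-checked sorry-free in the repair planner's LegCheck2.lean
(`existenceLegFromLatticeGapped_proof`) over the landed seam `oneField_of_latticeInequalities` +
`hypercubicLimit_iff_oneFieldWeak`; the earlier splits ExistenceLegFromLattice (rev 0, through the
unrepaired U) and ExistenceLegFromLatticeR (rev 6, through the refuted W₂) are landed,
`existenceLegFromLattice_proof` / `existenceLegFromLatticeR_proof`, and kept as asides): W₁
GapAtCorrelationLength
(∃, simple G, renormalisation-FREE: a weak-coupling scaling sequence with a volume-uniform lattice
mass gap Δ, its RP-spectral form, and at ONE past-supported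
bump u a polynomial floor a_k^p ≤ T⁰_k(u,θu) and a WINDOW T⁰_k(u,θu) ≤ M·T⁰_k(τ₋₁u,θτ₋₁u) on the
bare truncated plaquette two-point function — the gap is OF THE
ORDER of the inverse correlation length); U SelfNormalisedMomentBoundsR (∀ compact G, ∀ schemes:
weak coupling ∧ polynomial volumes ∧ PAST-SUPPORTED u ∧ floor ∧ window ⇒ the
k-uniform plane-resolved n!-moment bounds for the field SELF-NORMALISED by c'_k := 1/√T⁰_k(u,θu),
m'_k := ⟨tr U_p⟩_k — no ∃ over renormalisations; rev 6 REPAIR of SelfNormalisedMomentBounds,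
stmt-QuantumFields-18929, which lacked the past-support clause `tsupport u ⊆ {y | y 0 < 0}` of W₁/W₂
and is HELD by the refuter's negative lemma `SelfNormalisedMomentBounds_false_of_TwoRateWindowScheme
: TwoRateWindowScheme → ¬U` — a perversely windowed u = τ₊₁w admits collapsing-window two-rate
schemes; the held decl stays in the file as an aside); W₂ᴳ
SelfNormalisedSkewnessGapped (∀ compact G, ∀ window schemes WITH W₁'s volume-uniform lattice gap `0
< Δ ∧ HasLatticeMassGap r sch Δ`: the self-normalised field keeps a third-cumulant floor — rev 8
REPAIR of SelfNormalisedSkewness, stmt-QuantumFields-18944, REFUTED-MISSTATED by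
`Theorems.SelfNormalisedSkewness.Negative.not_SelfNormalisedSkewness`: along the super-weak U(1)₄
window scheme (β_k = (k+1)^96, a_k = 1/(k+1), L_k = (k+1)²) all four hypotheses of the gap-free W₂
hold while κ₃^canon of tr F² tends to its free-Maxwell value, which is ZERO — the tree-level
skewness of F_μνF_μν vanishes identically in d = 4 because the free field-strength covariance
anticommutes with the Hodge star (`treeLevelSkewness_vanishes`, `maxwellOddRing_eq_zero`); the gap
(binder Δ, `0 < Δ → HasLatticeMassGap r sch Δ →` inserted right after `sch.HasWeakCouplingLimit →`,
the refuter's C′) excludes exactly the two Maxwell-dominated families — Coulomb-phase U(1)₄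
(power-law tails, no volume-uniform gap) and deep-UV schemes a_kξ_k → ∞ (physical mass → 0) — and is
supplied by W₁ in the glue; the refuted decl stays in the file as a settled negative edge). It
suffices to show X = W₁ ∧ U_R ∧ W₂ᴳ ∧ CurvatureAmnesia (the
parent CoincidenceRotationBootstrap's Σ5 rotation crux, stmt-16192, shared verbatim): `closes` =
X₀_of_subs composed with `CoincidenceRotationBootstrap.closes`,
taking the shared PROVED support EuclideanUpgrade (the parent's stmt-QuantumFields-8647, landed as
`stub_upgrade`; here stmt-QuantumFields-18949) as a binder exactly as the parent does (cone repair
rev 4, 2026-08-17: the route file imports only the parent route and EuclideanAction).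
Lean: `Summit.QuantumFields.YangMills.Theses.ScalingWindowSplit.GapAtCorrelationLength ∧
Summit.QuantumFields.YangMills.Theses.ScalingWindowSplit.SelfNormalisedMomentBoundsR ∧
Summit.QuantumFields.YangMills.Theses.ScalingWindowSplit.SelfNormalisedSkewnessGapped ∧
Summit.QuantumFields.YangMills.Theses.ScalingWindowSplit.CurvatureAmnesia`

## Assembly
Pure logic over landed theorems (sorry-free: Sketch.lean `closes` / `assembly_proof`, = glue.lean
`closes`; axioms propext, Classical.choice, Quot.sound):
fix G; W₁ gives (r, sch, u, p, M, Δ, C) with u past-supported and the gap (Δ, hΔ, hgap); U_R at (G,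
r, sch, u) gives `UniformMomentBoundsPlanes r canon`; W₂ᴳ at (G, r, sch, u, p, M, Δ) — fed W₁'s gap
— gives the κ₃ floor of `canon`; the seam algebra
gives `IRInputs r canon` ((a),(b) are (c, m)-blind, (c) is the identity T^canon = 1, (d) is W₂ᴳ),
`PolyRenorm r canon` eventually (from the floor) and a
bounded counterterm; after the tail shift `subseq canon (· + k₀)` the landed
`oneFieldClauses_of_uniformMomentBoundsPlanes` + `hypercubicLimit_iff_oneFieldWeak`
give X₀ = HypercubicLimit; `CoincidenceRotationBootstrap.closes hAmnesia hX₀ hUpg` gives YangMills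
(hUpg : EuclideanUpgrade, proved by `stub_upgrade`). Since revs 1–3 the three lattice items carry
`PolyVolume`, `RPSpectral`, `UniformMomentBoundsPlanes` INLINED (delta-unfolded, `Iff.rfl` to the
rev-0 items), so the opener's `existenceLeg` proof applies verbatim after `show`; since rev 6
`closes hW hU hA hS hLeg hUpg := CoincidenceRotationBootstrap.closes hA (hLeg hW hS hU) hUpg` with
hU : SelfNormalisedMomentBoundsR, and since rev 8 with hS : SelfNormalisedSkewnessGapped and hLeg :
ExistenceLegFromLatticeGapped (Sketch.lean `closesG` and LegCheck2.lean `closes_check` /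
`assembly_check`, rc 0, 0 sorries, same axioms; BC7 `#h21_crux_probe` on both new decls: VERDICT
CLEAN).

Rationale: WHY THIS LINE. Both crux lines on X₀ (16154 coupling-response; 16120 trace-norm cold pressure)
converged on
ONE heart `LatticeCore = ∃ r sch, weak ∧ PolyVolume ∧ PolyRenorm ∧ UniformMomentBoundsPlanes ∧
IRInputs` and both leads asked the planners to promote it; promoting
it AS ONE ITEM would re-file the Clay core in lattice costume, so this route promotes it SPLIT along
the renormalisation seam — the IR piece W₁ is stated for the BARE lattice theory (β_k, a_k, L_k
only; `HasLatticeMassGap` and `RPSpectral` never read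
(c, m)), the UV piece U and the non-Gaussianity piece W₂ are stated for the CANONICALLY
SELF-NORMALISED field, and the seam identity (affine renormalisation
scales truncated two-point functions by c'², so c' = 1/√T⁰ makes the non-triviality floor ≡ 1, with
`PolyRenorm` read off the polynomial floor) is proved in
the glue; the WINDOW clause (ratio to the pair two time-units further apart) is exactly what
excludes the collapsing-window schemes on which U is false. What it buys (why-easier, named
tools): the continuum/OS passage that is an OPEN crux in every UV/IR-split route of the summit
(ConvexGribovBody.ContinuumLegGivenGap, OneCertifiedCube/LangevinControlUV.GapToContinuum,
FlowLineStateSpace.OSLimitFromUniformBounds a.o.)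
is here a THEOREM; U_R is ultraviolet stability of composite-field insertions with the infrared
regulator SUPPLIED by hypothesis — the setting of Bałaban's
programme (Balaban1985, Balaban1987RG1, Balaban1989LargeFieldII; Dimock2013) and of
MagnenRivasseauSeneor1993 (YM₄ with an IR cutoff); W₂ᴳ isolates NON-TRIVIALITY of the ONE-SCALE
scaling limit — κ₃ ≠ 0 for tr F², literally the Statement's `IsNonGaussian` clause read on the
lattice — the question Aizenman–Duminil-Copin settled
negatively for φ⁴₄ (AizenmanDuminilCopin2021). REV 8 LESSON (negative edge stmt-18944): the gap-free
W₂ claimed the floor for EVERY weak-coupling window scheme on the strength of "free Wick squares are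
skew"; for the O(4)-scalar F_μνF_μν in d = 4 that is false — every odd truncated function of the
free Wick square vanishes (the free field-strength covariance swaps self-dual and anti-self-dual
2-forms: `treeLevelSkewness_vanishes`, `maxwellOddRing_eq_zero`), and the lead prover inhabited the
disprover's `MaxwellDominatedWindowScheme` with the super-weak U(1)₄ scheme
(`not_SelfNormalisedSkewness`). So W₂ᴳ carries W₁'s volume-uniform gap: Coulomb-phase U(1)₄ and the
deep-UV schemes, the two Maxwell-dominated families, have no such gap, and what remains is the
one-scale regime Δ ≤ m_phys ≲ (log M)/2 where the claim is genuinely non-perturbative (leading order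
0; candidate mechanisms: the RG-forced one-loop scalar OPE coefficient ∝ b₀g²(r₀), and the
Feynman–Hellmann / action-sum-rule reading of κ₃ as the coupling-response of the window two-point
function; see TWO-LAYER PLAN). The group-dependence of Clay's problem stays confined to W₁ in the
sense that U_R and W₂ᴳ are typed group-blind (U_R holds — non vacuously — in the U(1)₄ Coulomb phase
of Guth1980 / FrohlichSpencer1982, where W₁ fails; W₂ᴳ is vacuous there for want of a gap), i.e. W₁
is Chatterjee's lattice mass-gap problem in its sharp
one-scale form (ChatterjeeYMProb2019, Chatterjee2021; finite-group analogue AdhikariCao2022).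
Imported areas: constructive RG (U_R), transfer-matrix / RP spectral theory (seam;
OsterwalderSeiler1978, GlimmJaffe1987), probability on lattice gauge theories (W₁).

RANKED CRUXES. #2 GapAtCorrelationLength (crux) — (W₁, IR, renormalisation-free) for every compact
simple G: a faithful r, a Wilson scheme AT WEAK COUPLING with polynomial volumes, Δ > 0 and C with
the volume-uniform lattice gap `HasLatticeMassGap r sch Δ` and its RP-spectral form, and ONE
past-supported real bump u, p, M with eventually a_k^p ≤ T⁰_k(u,θu) (polynomial floor of the BARE
truncated plaquette two-point function at the reflected pair) and T⁰_k(u,θu) ≤ M·T⁰_k(τ₋₁u, θτ₋₁u)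
(window: the physical mass is bounded ABOVE, the gap bounds it below — one scale). [difficulty:
open-problem] (why it might fail: It is the lattice confinement/mass-gap problem at β→∞ for simple G
(Chatterjee's open problems), no expansion controls it; verbatim FALSE for U(1)₄ (Guth1980: Coulomb
phase, no uniform gap) and for finite G (freezing: no polynomial floor), so simplicity AND
continuity of G must both be used.) [ChatterjeeYMProb2019, Chatterjee2021, AdhikariCao2022,
OsterwalderSeiler1978, Guth1980, FrohlichSpencer1982, JaffeWitten2000]
#3 SelfNormalisedMomentBoundsR (crux) — (U_R, UV, group-blind, no existential; rev 6 repair of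
SelfNormalisedMomentBounds) for every compact G, faithful r, scheme at weak coupling with polynomial
volumes, PAST-SUPPORTED bump u, p, M with the floor and the window at u: the plane-resolved smeared
plaquette fields of the SELF-NORMALISED scheme `canon` (c'_k := 1/√T⁰_k(u,θu), m'_k := ⟨action
density⟩_k; a, β, L unchanged) obey `UniformMomentBoundsPlanes r canon` (inlined): |∫∏ᵢΦ(Fᵢ)dμ_k| ≤
C₀C₁ⁿn! for all n, k and all normalised pairwise plane-wise disjoint tuples; contains the deep-UV
schemes and the abelian Coulomb phase as genuine (true, Gaussian-dominated) sub-cases. [difficulty: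
open-problem] (why it might fail: k-uniform n!-bounds for composite insertions need Bałaban-type
small/large-field control inside the correlation length, never completed for observables (the
programme stops at the free energy); as typed ∀-schemes, one window scheme with an unbounded
self-normalised 4-point function kills it.) [Balaban1985, Balaban1987RG1, Balaban1989LargeFieldII,
MagnenRivasseauSeneor1993, Dimock2013, GlimmJaffe1987, Guth1980, FrohlichSpencer1982] ASIDE (not
staffed, kept verbatim because two landed files name it): SelfNormalisedMomentBounds
(stmt-QuantumFields-18929, the same statement WITHOUT the past-support clause) — HELD by the
refuter's negative lemma
`Theorems.SelfNormalisedMomentBounds.Negative.SelfNormalisedMomentBounds_false_of_TwoRateWindowScheme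
: TwoRateWindowScheme → ¬U` (a perverse window u = τ₊₁w straddling x⁰ = 0 meets floor ∧ window along
collapsing-window two-rate schemes; H not constructible); U → U_R trivially
(`selfNormalisedMomentBoundsR_of_original`).
#4 CurvatureAmnesia (crux) — (shared verbatim with CoincidenceRotationBootstrap,
stmt-QuantumFields-16192: ORIENTATION AMNESIA) every weak-coupling Wilson limit family S over all
gauge-invariant species with E0, E0', E2, E3, E4, translations and proper-hypercubic invariance on
⁰𝒮, the IsYangMillsFor convergence, non-triviality of tr F² and a continuum + uniform lattice gap
has Σ5-invariant (cos θ = 3/5 rotation in the (x₂,x₃)-plane) curvature-species Schwinger functions.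
[difficulty: open-problem] (why it might fail: Non-perturbative (a/ℓ)² irrelevance of the
W(B₄)-scalar dim-6 O(4)-breaking operators (Weisz1983) along weak-coupling Wilson schemes is
unproved — no small parameter but (a/ℓ)²; the guards alone never force Σ5-blindness
(e1-counterexample-zoo).) [Symanzik1983, Weisz1983, LuscherWeisz1985, LangRebbi1982,
DavoudiSavage2012, DKKMO2020Rotational]
#5 SelfNormalisedSkewnessGapped (crux) — (W₂ᴳ, non-triviality at ONE scale; rev 8 repair of
SelfNormalisedSkewness = the refuter's C′, `Repaired.lean` on stmt-18944) for every compact G,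
faithful r, weak-coupling scheme sch, past-supported bump u, p, M and Δ > 0 WITH the volume-uniform
lattice gap `HasLatticeMassGap r sch Δ` (W₁'s own clause, inserted right after
`sch.HasWeakCouplingLimit →`), polynomial volumes and the floor and the window at u: there are
pairwise disjointly supported real tests f, g, h and δ > 0 such that eventually the third cumulant
of the SELF-NORMALISED curvature field (the exact IRInputs-(d) expression, scheme `canon`) is ≥ δ in
size — the dimensionless skewness κ₃/T^(3/2) of tr F² at the correlation-length scale stays away
from 0. Gap ∧ window pin ONE scale; the Coulomb phase and the deep-UV schemes that killed W₂ are
excluded by the gap, finite G by the floor, collapsing windows by the window. [difficulty: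
open-problem] (why it might fail: Leading order is ZERO (treeLevelSkewness_vanishes): no expansion
supports it; a gapped one-scale limit of tr F² with vanishing 3-point function at separated points
(φ⁴₄-type Gaussian fate, AizenmanDuminilCopin2021), or one disjoint triple not serving every
subsequential limit, breaks it.) [AizenmanDuminilCopin2021, Chatterjee2026YMHiggs, Michael1987,
MontvayMunster1994, GlimmJaffe1987, JaffeWitten2000,
lean:Summit.QuantumFields.YangMills.Theorems.SelfNormalisedSkewness.Negative.treeLevelSkewness_vanishes]
SETTLED NEGATIVE EDGE (kept verbatim in the file; `ledger negatives`): SelfNormalisedSkewness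
(stmt-QuantumFields-18944, the same floor WITHOUT the gap, ∀ weak-coupling window schemes) —
REFUTED-MISSTATED by `Theorems.SelfNormalisedSkewness.Negative.not_SelfNormalisedSkewness`
(@3971caa22676: the super-weak U(1)₄ scheme β_k = (k+1)^96, a_k = 1/(k+1), L_k = (k+1)², p = 201
meets all four hypotheses while κ₃^canon_k = O((k+1)^{-1/2}) → 0 for every disjoint triple — the
disprover's `MaxwellDominatedWindowScheme` inhabited); W₂ → W₂ᴳ trivially
(`selfNormalisedSkewnessGapped_of_original`, repair Sketch.lean).
#9 ExistenceLegFromLatticeGapped (support) — THE TYPED SPLIT re-pointed at the repaired W₂ᴳ (rev 8):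
GapAtCorrelationLength → SelfNormalisedSkewnessGapped → SelfNormalisedMomentBoundsR →
CoincidenceRotationBootstrap.HypercubicLimit, BY NAME; PROVED sorry-free in the repair planner's
LegCheck2.lean (`existenceLegFromLatticeGapped_proof` = the landed `existenceLegFromLatticeR_proof`
with W₁'s `Δ hΔ hgap` also fed to W₂ᴳ; rc 0, 0 sorries, axioms propext/Classical.choice/Quot.sound;
attached as evidence); `closes` takes it as a binder; a prover lands it verbatim as
Theorems/ScalingWindowSplitExistenceLegFromLatticeGapped.lean importing
Theorems.ScalingWindowSplitExistenceLegFromLattice (heavy cone harmless in Theorems). [difficulty: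
provable-now] [GlimmJaffe1987, OsterwalderSeiler1978]
#9 ExistenceLegFromLatticeR (support, ASIDE since rev 8 — proved by `existenceLegFromLatticeR_proof`
@ eb7ac4f4dfa7; the rev-6 split through the refuted W₂, implied by ExistenceLegFromLatticeGapped via
`existenceLegFromLatticeR_of_gapped`, kept verbatim because the landed proof names it) —
GapAtCorrelationLength → SelfNormalisedSkewness → SelfNormalisedMomentBoundsR →
CoincidenceRotationBootstrap.HypercubicLimit, BY NAME. [difficulty: provable-now — proved]
[GlimmJaffe1987, OsterwalderSeiler1978]
#9 ExistenceLegFromLattice (support, ASIDE since rev 6 — proved by `existenceLegFromLattice_proof` @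
0bcb53304c13; the rev-0 split through the unrepaired U, kept verbatim because the landed proof names
it) — GapAtCorrelationLength → SelfNormalisedSkewness → SelfNormalisedMomentBounds →
CoincidenceRotationBootstrap.HypercubicLimit, BY NAME [difficulty: provable-now — proved]
[GlimmJaffe1987, OsterwalderSeiler1978]
#9 EuclideanUpgrade (support) — shared verbatim with the parent's stmt-QuantumFields-8647 (DENSITY
UPGRADE: proper-hypercubic + Σ5 invariance on ⁰𝒮 ⇒ SO(4) invariance), ALREADY PROVED as
`Cruxes.OSLegsFromFemtoAndGap.DlrCollarTransfer.stub_upgrade`; a binder of `closes` only so that the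
route file need not import that Theorems module; closes by the one-line Theorems proof `theorem
euclideanUpgrade_holds : ScalingWindowSplit.EuclideanUpgrade := stub_upgrade`. [difficulty:
provable-now] [DKKMO2020Rotational, OsterwalderSchrader1973, Niven1956]

TWO-LAYER PLAN. Foreseen glued splits (none filed now; the BC3 birth skeletons are published under
each crux's `Lines/birth.lean`): W₁ ⇐ OneScaleFamily (IR in lattice
units: a mass function m(β) > 0, m → 0 — no freezing — such that EVERY scheme tracking a_k = m(β_k)
has gap 1, RP-spectral 1 and floor∧window at
u) → TrackingScheme (provable-now construction) → W₁; U ⇐ TwoPointBounds (n ≤ 2: scaling-dimension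
control of the
self-normalised field, any disjoint pair comparable to the reference pair) → AllOrdersFromTwo
(cluster/OPE structure) → U, or alternatively U ⇐
ResponseHolomorphyOnePlanes for `canon` by the landed `stub_derivToMomentsPlanes ∘
responseDerivBoundsPlanes_of_holomorphy` (the 16154 line's C⁺); W₂ᴳ ⇐ (the birth skeleton's
ThirdCumulantScaling, the provable-now order-3 seam identity, → BareSkewRatio δ·T³ ≤ κ₃⁰² survives
as bookkeeping, but the bare ratio now needs a MECHANISM) one of the three crux ideas filed on
stmt-18944 and typed against C′ = W₂ᴳ: running-gap-sum-rule (κ₃ with the middle leg in the unit slab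
= ∂_t of the window two-point function under a local coupling shift, `LocalResponseIdentity`
provable now; transfer `ResponseGrowth`: the levels carrying Φ(u)Ω run down with β at a uniform rate
— uses the gap twice), hellmann-feynman-slab (mirror geometry: κ₃ = excess action of the state
e^{-H}Φ(u)Ω = −∂_βE by Feynman–Hellmann, sign-definite; transfer `GapRunsWithCoupling`),
trace-anomaly-ope (hug the pinned pair with a third bump at fixed small physical distance r₀: the
scalar self-OPE coefficient of θ×θ→θ is pure contact at tree level, `trace_K_eq`, so RG invariance
forces a separated-point one-loop coefficient ∝ b₀g²(r₀) ≠ 0 — rides on U_R's UV technology). The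
twin line's cold pressure is a landed sufficient condition for W₁'s gap clauses
(`irInputsAB_of_coldPressure`).

KILL CRITERIA. (Executed twice. Rev 8: the gap-free W₂ SelfNormalisedSkewness was refuted-MISSTATED
— disprover's negative lemma `SelfNormalisedSkewness_false_of_MaxwellDominatedWindowScheme` + the
lead's U(1)₄ inhabitant `maxwellDominatedWindowScheme_holds`, root cause
`treeLevelSkewness_vanishes` — and superseded by W₂ᴳ = SelfNormalisedSkewnessGapped carrying W₁'s
gap; with `SelfNormalisedSkewnessFalseWithoutFloor` (trivial group) gap, floor, window and past
support are each spent once — no clause of W₁ is in reserve. Rev 6: the refuter's birth attack found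
U misstated — no past-support clause, so a self-overlapping τ₋₁u makes the window vacuous and
collapsing-window two-rate schemes meet it — and U was superseded by U_R =
SelfNormalisedMomentBoundsR with W₂'s clause; with past support the one-step window caps the
physical mass, and by spectral log-convexity it propagates to all translates, so no further clause
is in reserve.) A window scheme (G, r, sch, PAST-SUPPORTED u meeting weak coupling, PolyVolume,
floor ∧ window) with unbounded self-normalised moments refutes U_R and closes the route
`refuted:SelfNormalisedMomentBoundsR` (substantive);
a GAPPED one-scale window scheme (weak coupling, PolyVolume, past-supported u, floor ∧ window AND
`HasLatticeMassGap r sch Δ`, Δ > 0) along which every disjoint triple has κ₃^canon → 0 refutes W₂ᴳ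
and closes the route `refuted:SelfNormalisedSkewnessGapped` (substantive: Clay's `IsNonGaussian`
clause for tr F²
itself is then in doubt for that G — no further hypothesis of W₁ is left to add); ¬W₁ for some
compact simple G (no one-scale gapped weak-coupling sequence) kills the existence leg in this
currency for
every E1 route — pivot to the cold-pressure heart of the twin line or retire; CurvatureAmnesia
refuted → re-glue the same three items through
MirrorModularBoosts.closes (K, B′, D) — the split is parent-independent (support
ExistenceLegFromLatticeGapped); HypercubicLimit proved elsewhere moots W₁, U_R, W₂ᴳ as a
package (close `superseded`).

NOT DECOMPOSED YET. The lattice-units form of W₁ (mass function, no-freezing, tracking schemes), the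
order split of U and its coupling-response form, the order-3 seam identity
of W₂ᴳ and its three mechanism candidates (crux ideas on stmt-18944, to be re-attached to the W₂ᴳ
item by the crux chain) — all typed and kernel-composed in the birth skeletons / ideator sketches
but filed only after a crux moves (layer 2, D-0019); further splits of CurvatureAmnesia belong to
its home route; the abelian special case of U_R (U(1)₄ Coulomb phase: Wick-square moments +
Guth/Fröhlich–Spencer error control — the lead's landed U(1) witness chain
Theorems/ScalingWindowSplitSelfNormalisedSkewnessWitness*.lean already controls κ₂ and κ₃ there) is
a natural
first target for the U_R lead, not an item; W₂ᴳ has NO abelian or perturbative special case left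
(that is the content of the rev-8 refutation).

CHEAPEST FALSIFIER. Junk-scheme attack (the refuter's first move, and mine before typing): bounded
or zero β (excluded by `HasWeakCouplingLimit`), c ≡ 0 / vacuum families (irrelevant: U_R and W₂ᴳ
carry NO existential over renormalisations — the field is self-normalised), G = PUnit or finite G
(T⁰ ≡ 0 resp. frozen: the floor fails, vacuous — `SelfNormalisedSkewnessFalseWithoutFloor` shows the
floor is what stops the trivial group), the collapsing window a_kξ_k → 0 (excluded by the window AT
A PAST-SUPPORTED u; without either U is false: negative lemma
`SelfNormalisedMomentBounds_false_of_TwoRateWindowScheme`, rev 6), the deep-UV scheme a_kξ_k → ∞ and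
the U(1)₄ Coulomb phase (U_R true there, Gaussian-dominated; W₂ was KILLED there at rev 8 —
tree-level skewness of F_μνF_μν is 0 — and W₂ᴳ excludes both by the volume-uniform gap). For W₂ᴳ no
admissible datum is constructible today (a gapped weak-coupling window scheme IS W₁), so the
cheapest informative computation is structural: the pure number κ in the RG-forced one-loop scalar
OPE coefficient C_θ(r) = κ·b₀g²(r)/r⁴ of tr F² × tr F² → tr F² (crux idea trace-anomaly-ope) — κ = 0
would void the last perturbative support (informative, not a kill) — and, numerically, the
confinement-scale three-point function of the action density in SU(2)/SU(3) lattice data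
(scalar-glueball cubic coupling; action sum rules, Michael1987), expected ≠ 0. In Lean: BC2 probes C
→ YangMills / YangMills → C fail for all cruxes (BC7 P5 on W₂ᴳ: ok), BC4 `exact?` finds nothing, the
split is kernel-checked (LegCheck2.lean rc 0, 0 sorries; axioms propext, Classical.choice,
Quot.sound).

NUMBERS. tr F² has canonical dimension 4: the bare truncated two-point function at physical
separation ~1 scales like a_k⁸ (× logs) in the window, so p = 8 + ε is the expected floor exponent
and c'_k ≍ a_k⁻⁴; PolyRenorm exponent Q = p; window ratio M ≍ e^(2m_phys) with Δ ≤ m_phys ≤ (log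
M)/2 (one scale); IRInputs-(c) floor of the self-normalised field is EXACTLY 1 (identity), (d) floor
√δ from δ·T³ ≤ κ₃⁰²; along the refuting U(1)₄ scheme T⁰_k ≍ a_k⁸β_k⁻² = (k+1)^{-200} and κ₃^canon =
O((k+1)^{-1/2}). Landed chain consumed: p136824 (34 landings, ≈ 7 900 lines) + `stub_upgrade`
(stmt-8647) + `CoincidenceRotationBootstrap.closes`. Cone (revs 1–4): heavy Theorems imports cut by
inlining `PolyVolume`, `RPSpectral`, `UniformMomentBoundsPlanes` (Iff.rfl-certified) and taking the
proved EuclideanUpgrade as a binder — import cone 310 → 32 modules (the Statement's chain +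
CoincidenceRotationBootstrap), needs-fact: none. Items: 6 at open; 7 after revs 1–5; 9 after rev 6
(+SelfNormalisedMomentBoundsR crux r3, +ExistenceLegFromLatticeR support; 2 asides); rev 8
(route-repair after BROKEN, 2026-08-17): +2 (SelfNormalisedSkewnessGapped crux r5 = C′;
ExistenceLegFromLatticeGapped support, proved in LegCheck2.lean) = 11 items (+3 replaced records), 4
active cruxes (W₁ r2, U_R r3, CurvatureAmnesia r4, W₂ᴳ r5), `closes` binders W₁, U_R,
CurvatureAmnesia, W₂ᴳ, Leg_G, EuclideanUpgrade — every binder load-bearing; asides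
SelfNormalisedSkewness (refuted, negative edge), SelfNormalisedMomentBounds (held),
ExistenceLegFromLattice / ExistenceLegFromLatticeR / Assembly (proved against earlier statements);
imports unchanged; BC7 probes of both new decls CLEAN.

DEFINITION REQUESTS. None: `UniformMomentBoundsPlanes`, `PolyVolume`, `PolyRenorm`, `IRInputs`,
`RPSpectral`, `subseq`, `fieldP` (Theorems/MirrorModularBoostsHypercubicLimit*Defs; the first three
INLINED in the items since revs 1–3 — a light re-homing next to YangMillsOS would let them be
re-folded by name), `thetaTest`, `timeShiftTest` (EuclideanAction), `latticeSchwinger`,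
`HasLatticeMassGap`, `SpeciesScheme` (YangMillsOS) all exist; the bare and self-normalised schemes
are inline `let`s over the `SpeciesScheme` record.

Novelty: Searches (2026-08-17): `lit search` local/hybrid (searchd connection reset ×2 — service unavailable,
recorded), `--source openalex` (HTTP 429 budget exhausted),
`--source s2 "Yang-Mills mass gap lattice" --year-from 2015` (15 rows: CaoNissimSheffield2025
arXiv:2509.04688 area law dynamics, Nissim arXiv:2510.22788,
ShenZhuZhu arXiv:2401.13299 / doi:10.1007/s00220-022-04609-1, Faria da Veiga–O'Carroll
arXiv:2509.03513, several non-rigorous claims arXiv:2506.00284,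
doi:10.1142/s0219887826501136), `--source crossref` (FrohlichSpencer1982 located,
doi:10.1007/bf01213610, bib added), `lit frontier QuantumFields --since 2021`
(30 rows: Chatterjee2026YMHiggs arXiv:2401.10507 Gaussian SU(2) YMH scaling limit, Nature Rev. Phys.
doi:10.1038/s42254-025-00909-2 survey, arXiv:2602.21679,
arXiv:2605.02156), `lit galaxy search "ultraviolet stability" --star all` (24 rows, noise +
Benfatto–Gallavotti, Friz–König LNs), `ledger negatives` (5; none
near), `ledger idea list --sub YangMills --status all` (77 cards; none on self-normalisation /
lattice-core promotion), tree reads of both crux lines' reports.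
Nearest prior art found: in the tree, the two crux lines on stmt-16154/16120
(`hypercubicLimit_of_lineInputsPlanes` p136824; r11 heart `stub_latticeCore`,
Cruxes/WeakCouplingHypercubicLimit/Lines/Sketch.lean) whose leads recommend promoting ONE core item,
and route LangevinControlUV (UV ∧ IR ∧ OS legs in
continuous intrinsic units, OS legs an OPEN crux); in print MagnenRivasseauSeneor1993 (UV w  [refs: 10.1007/s00220-022-04609-1, 10.1142/s0219887826501136, 10.1007/bf01213610, 10.1038/s42254-025-00909-2, 2509.04688, 2510.22788, 2401.13299, 2509.03513, 2506.00284, 2401.10507, 2602.21679, 2605.02156, doi:10.1007/s00220-022-04609-1, doi:10.1142/s0219887826501136, doi:10.1007/bf01213610, doi:10.1038/s42254-025-00909-2, CaoNissimSheffield2025, FrohlichSpencer1982, MagnenRivasseauSeneor1993, Dimock2013]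

Barriers (technique_class: constructive-rg, reflection-positivity, lattice-ir): - technique_class: constructive-rg, reflection-positivity, lattice-ir
- Literature.Barriers.QuantumFields.AbelianDeconfinementD4: respected and made structural — U and W₂
are group-blind by design and HOLD (non-vacuously) in the U(1)₄ Coulomb phase; the only
group-sensitive item W₁ carries `IsCompactSimpleLieGroup G`, so no group-blind argument is asked to
produce the gap.
- Literature.Barriers.QuantumFields.ZnHiggsPhaseD4: (DiscreteSubgroupFreezing) a frozen finite-group
theory has no polynomial floor at physical separation, so U and W₂ are vacuous there and W₁ demands
m(β) → 0 (stub OneScaleFamily's `Tendsto m atTop (𝓝 0)`): no discrete approximation is used along β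
→ ∞.
- Literature.Barriers.QuantumFields.UVStabilityNonUniqueness: uniqueness of the continuum limit is
never used — the assembly extracts a subsequence (`subseq`, `stub_planeLimits`) exactly as the
Statement's sequential clause allows.
- Literature.Barriers.QuantumFields.PerturbativeInvisibility: the gap lives only in W₁
(non-perturbative, ∃); U is where perturbative/RG control is legitimate (bounds, not the gap), W₂
needs only leading-order non-vanishing.
- Literature.Barriers.QuantumFields.FixedCouplingUltralocality: fixed-β or bounded-β "limits" are
excluded by `HasWeakCouplingLimit` in all three items; c-number limits are excluded by the floor (T⁰
≡ 0 fails a_k^p ≤ T⁰).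
- Literature.Barriers.QuantumFields.ScalarPhi4Triviality: it does not apply to gauge theory, but it
IS the failure mode of W₂ made explicit

History (route lifecycle, newest last):
- 2026-08-17T03:07:48Z · rev 2: restated SelfNormalisedMomentBounds (stmt-QuantumFields-18655) — cone repair 2/4: restate SelfNormalisedMomentBounds with PolyVolume and UniformMomentBoundsPlanes (fieldP/planeField/planeSpecies.F/normP/DisjP/wilsonAt/Plane) (planner-rrepair-QuantumFields-ScalingWindowSpl-58d14312-0)
- 2026-08-17T03:08:10Z · rev 3: restated SelfNormalisedSkewness (stmt-QuantumFields-18656) — cone repair 3/4: restate SelfNormalisedSkewness with PolyVolume inlined verbatim (Iff.rfl to stmt-QuantumFields-18656, certified in DefEq.lean); statement uncha (planner-rrepair-QuantumFields-ScalingWindowSpl-58d14312-0)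
- 2026-08-17T11:39:29Z · BROKEN — SelfNormalisedSkewness (stmt-QuantumFields-18944, crux) refuted by Summit.QuantumFields.YangMills.Theorems.SelfNormalisedSkewness.Negative.not_SelfNormalisedSkewness @ 3971caa22676 (prover-line-stmt-QuantumFields-18944-0)
- 2026-08-17T12:28:38Z · rev 9: dropped SelfNormalisedSkewness — rev 8c (clear BROKEN): drop this route's want of the refuted W₂ SelfNormalisedSkewness (stmt-18944, refuted-misstated by not_SelfNormalisedSkewness; superseded (planner-rfix-QuantumFields-ScalingWindowSpli-58d14312-0)
- 2026-08-17T12:28:38Z · REPAIRED (drop SelfNormalisedSkewness) — back to open: rev 8c (clear BROKEN): drop this route's want of the refuted W₂ SelfNormalisedSkewness (stmt-18944, refuted-misstated by not_SelfNormalisedSkewness; superseded (planner-rfix-QuantumFields-ScalingWindowSpli-58d14312-0)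
- 2026-08-26T19:37:45Z · DORMANT — reconciler: no traction for 5 d (last activity item-evidence-added at 2026-08-21T18:47:55Z); parked, not closed — `ledger route dormant route-QuantumFields-Scal (operator:999:2697885)
- 2026-08-31T15:28:16Z · REACTIVATED (open) — director-ym g23 O4 WORD 18 (1): transient reactivation only to re-render via --retriage; 0 seats; re-park after (operator:999:3639776)
- 2026-08-31T15:28:23Z · DORMANT — re-park after R688 (3′) (director-ym g23 O4 WORD 18 (1); 0 seats) (operator:999:3642633)

sub-problem: YangMills · status: dormant · opened planner-plan-lens3-QuantumFields-decomp-g2-0 2026-08-17T02:53:40Z · rev 8 · ledger route-QuantumFields-ScalingWindowSplit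
GENERATED by the gate from the ledger (D-0016/17). Provers cite these decls: `theorem foo : Summit.QuantumFields.YangMills.Theses.ScalingWindowSplit.<Decl> := …` in Summits/QuantumFields/YangMills/Theorems/<Name>.lean.
-/

namespace Summit.QuantumFields.YangMills.Theses.ScalingWindowSplit

open scoped BigOperators Topology Manifold Classical MeasureTheory ProbabilityTheory Matrix InnerProductSpace ComplexConjugate ContinuousMap
open Filter Set Function TopologicalSpace MeasureTheory

attribute [summit_statement] _root_.YangMills

/-! Retired items kept as plain definitions (history; not obligations of this route): landed proofs / closed glue still name them. -/

-- tombstone: stmt-QuantumFields-18944 was DROPPED from this route but is still named by active items / landed proofs — kept as a plain def (no route_item tag), not an obligation of this route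
/-- retired stmt-QuantumFields-18944 (dropped, gen None) — refuted by Summit.QuantumFields.YangMills.Theorems.SelfNormalisedSkewness.Negative.not_SelfNormalisedSkewness @ 9e633e60c564. -/
def SelfNormalisedSkewness : Prop :=
  open Literature.MathematicalPhysics.QuantumLattice Literature.MathematicalPhysics.AQFT Literature.MathematicalPhysics.QuantumFieldTheory in let E := EuclideanSpace ℝ (Fin 4); ∀ (G : Type) [Group G] [TopologicalSpace G] [IsTopologicalGroup G] [CompactSpace G] [MeasurableSpace G] [BorelSpace G] (r : LatticeRep G) (sch : SpeciesScheme (YMSpecies G)) (u : SchwartzMap E ℝ) (p : ℕ) (M : ℝ), let bare : SpeciesScheme (YMSpecies G) := { sch with c := fun _ _ => 1, m := fun _ _ => 0 }; let T : SchwartzMap E ℝ → ℕ → ℝ := fun w k => latticeSchwinger r.ρ bare (fun s => s.F) k (1 + 1) (fun _ => r.curvature) ![w, thetaTest 4 w] - latticeSchwinger r.ρ bare (fun s => s.F) k 1 (fun _ => r.curvature) ![w] * latticeSchwinger r.ρ bare (fun s => s.F) k 1 (fun _ => r.curvature) ![thetaTest 4 w]; let canon : SpeciesScheme (YMSpecies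 G) := { sch with c := fun _ k => (Real.sqrt (T u k))⁻¹, m := fun _ k => ∫ U, r.curvature.F (torusLift (sch.side k) U) ∂(wilsonMeasure r.ρ (sch.β k)) }; sch.HasWeakCouplingLimit → (∃ N : ℕ, 1 ≤ N ∧ ∀ᶠ k in Filter.atTop, (sch.a k)⁻¹ ≤ (sch.a k * (sch.L k : ℝ)) ^ N) → tsupport u ⊆ {y : E | y 0 < 0} → (∀ᶠ k in Filter.atTop, (sch.a k) ^ p ≤ T u k ∧ T u k ≤ M * T (timeShiftTest 4 (-1) u) k) → ∃ (f g h : SchwartzMap E ℝ) (δ : ℝ), Disjoint (tsupport f) (tsupport g) ∧ Disjoint (tsupport f) (tsupport h) ∧ Disjoint (tsupport g) (tsupport h) ∧ 0 < δ ∧ ∀ᶠ k in Filter.atTop, δ ≤ |latticeSchwinger r.ρ canon (fun s => s.F) k 3 (fun _ => r.curvature) ![f, g, h] - latticeSchwinger r.ρ canon (fun s => s.F) k 1 (fun _ => r.curvature) ![f] * latticeSchwinger r.ρ canon (fun s => s.F) k 2 (fun _ => r.curvature) ![g, h] - latticeSchwinger r.ρ canon (fun s => s.F) k 1 (fun _ =>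 r.curvature) ![g] * latticeSchwinger r.ρ canon (fun s => s.F) k 2 (fun _ => r.curvature) ![f, h] - latticeSchwinger r.ρ canon (fun s => s.F) k 1 (fun _ => r.curvature) ![h] * latticeSchwinger r.ρ canon (fun s => s.F) k 2 (fun _ => r.curvature) ![f, g] + 2 * (latticeSchwinger r.ρ canon (fun s => s.F) k 1 (fun _ => r.curvature) ![f] * latticeSchwinger r.ρ canon (fun s => s.F) k 1 (fun _ => r.curvature) ![g] * latticeSchwinger r.ρ canon (fun s => s.F) k 1 (fun _ => r.curvature) ![h])|

-- earlier GapAtCorrelationLength (stmt-QuantumFields-18654, replaced 2026-08-17T03:07:29Z -> stmt-QuantumFields-18927): retired by None — open Literature.MathematicalPhysics.QuantumLattice Literature.MathematicalPhysics.AQFT Literature.MathematicalPhysics.QuantumFieldTheory Summit.QuantumFields.YangMills.Cruxes.HypercubicLimit.CouplingResponse in let E := EuclideanSpace ℝ (Fin 4); ∀ (G : Type) [Grou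
/-- item stmt-QuantumFields-18927 · crux · rank 2 · open · by planner
why it might fail: It is the lattice confinement/mass-gap problem at β→∞ for simple G (Chatterjee's open problems), no expansion controls it; verbatim FALSE for U(1)₄ (Guth1980: Coulomb phase, no uniform gap) and for finite G (freezing: no polynomial floor), so simplicity AND continuity of G must both be used.
sources: ChatterjeeYMProb2019, Chatterjee2021, AdhikariCao2022, OsterwalderSeiler1978, Guth1980, FrohlichSpencer1982
[crux] (W₁, IR, renormalisation-free) for every compact simple G there are a faithful r, a Wilson
scheme sch AT WEAK COUPLING with polynomial volume growth, Δ > 0 and C with the volume-uniform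
lattice mass gap `HasLatticeMassGap r sch Δ` and its RP-spectral form `RPSpectral r sch Δ C`, and
ONE real bump u supported at negative times, p and M such that eventually a_k^p ≤ T⁰_k(u,θu)
(polynomial floor of the BARE truncated plaquette two-point function at the reflected pair; c ≡ 1, m
≡ 0) and T⁰_k(u,θu) ≤ M·T⁰_k(τ₋₁u, θτ₋₁u) (window: the pair two physical time-units further apart
keeps a fixed fraction — the physical mass is bounded ABOVE, the gap bounds it below: one scale).
[difficulty: open-problem] CONE REPAIR rev 1 (2026-08-17): `PolyVolume sch` and `RPSpectral r sch Δ
C` are INLINED verbatim (delta-unfolded; `Iff.rfl` to the rev-0 item stmt-QuantumFields-18654,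
certified in the repair planner's DefEq.lean) so that the route file imports only the parent route
and EuclideanAction — statement unchanged up to definitional unfolding. -/
@[route_item "route-QuantumFields-ScalingWindowSplit", crux]
def GapAtCorrelationLength : Prop :=
  open Literature.MathematicalPhysics.QuantumLattice Literature.MathematicalPhysics.AQFT Literature.MathematicalPhysics.QuantumFieldTheory in let E := EuclideanSpace ℝ (Fin 4); ∀ (G : Type) [Group G] [TopologicalSpace G] [IsTopologicalGroup G] [CompactSpace G], IsCompactSimpleLieGroup G → letI : MeasurableSpace G := borel G; haveI : BorelSpace G := ⟨rfl⟩; ∃ (r : LatticeRep G) (sch : SpeciesScheme (YMSpecies G)) (u : SchwartzMap E ℝ) (p : ℕ) (M Δ C : ℝ), let bare : SpeciesScheme (YMSpecies G) := { sch with c := fun _ _ => 1, m := fun _ _ => 0 }; let T : SchwartzMap E ℝ → ℕ → ℝ := fun w k => latticeSchwinger r.ρ bare (fun s => s.F) k (1 + 1) (fun _ => r.curvature) ![w, thetaTest 4 w] - latticeSchwinger r.ρ bare (fun s => s.F) k 1 (fun _ => r.curvature) ![w] * latticeSchwinger r.ρ bare (fun s => s.F) k 1 (fun _ => r.curvature)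 ![thetaTest 4 w]; sch.HasWeakCouplingLimit ∧ (∃ N : ℕ, 1 ≤ N ∧ ∀ᶠ k in Filter.atTop, (sch.a k)⁻¹ ≤ (sch.a k * (sch.L k : ℝ)) ^ N) ∧ 0 < Δ ∧ HasLatticeMassGap r sch Δ ∧ (∀ᶠ k in Filter.atTop, ∀ (S₀ T₀ n : ℕ), sch.L k ≤ S₀ → 2 * (T₀ + n + 1) ≤ S₀ → ∀ (Y : LGConfig 4 G → ℝ) (B : ℝ), Measurable Y → (∀ U, |Y U| ≤ B) → DependsOn Y {e : Literature.MathematicalPhysics.QuantumLattice.ZdEdge 4 | 1 ≤ e.1 0 ∧ e.1 0 + (if e.2 = 0 then 1 else 0) ≤ T₀} → |(∫ U, Y (torusLift (2 * S₀ + 1) (GaugeConfig.timeReflect U)) * Y (configShift (-Pi.single 0 (n : ℤ)) (torusLift (2 * S₀ + 1) U)) ∂(wilsonMeasure r.ρ (sch.β k) : Measure (GaugeConfig 4 (2 * S₀ + 1) G))) - (∫ U, Y (torusLift (2 * S₀ + 1) U) ∂(wilsonMeasure r.ρ (sch.β k) : Measure (GaugeConfig 4 (2 * S₀ + 1) G)))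 ^ 2| ≤ Real.exp (-(Δ * sch.a k * n)) * ((∫ U, Y (torusLift (2 * S₀ + 1) (GaugeConfig.timeReflect U)) * Y (torusLift (2 * S₀ + 1) U) ∂(wilsonMeasure r.ρ (sch.β k) : Measure (GaugeConfig 4 (2 * S₀ + 1) G))) - (∫ U, Y (torusLift (2 * S₀ + 1) U) ∂(wilsonMeasure r.ρ (sch.β k) : Measure (GaugeConfig 4 (2 * S₀ + 1) G))) ^ 2) + C * B ^ 2 * Real.exp (-(Δ * sch.a k * S₀))) ∧ tsupport u ⊆ {y : E | y 0 < 0} ∧ ∀ᶠ k in Filter.atTop, (sch.a k) ^ p ≤ T u k ∧ T u k ≤ M * T (timeShiftTest 4 (-1) u) k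

/-- item stmt-QuantumFields-18014 · crux · rank 3 · open · by planner
why it might fail: k-uniform n!-bounds for tr F² insertions need Bałaban-type small/large-field control down to the correlation length, never completed for observables (the programme stops at effective actions); with the honest window, a weak-coupling scheme with k-unbounded self-normalised 4-point function kills it.
sources: Balaban1985, Balaban1987RG1, Balaban1989LargeFieldII, MagnenRivasseauSeneor1993, Dimock2013, GlimmJaffe1987
[crux] REPAIRED U (rev 6; supersedes SelfNormalisedMomentBounds = stmt-QuantumFields-18929, HELD by
the negative lemma
Theorems.SelfNormalisedMomentBounds.Negative.SelfNormalisedMomentBounds_false_of_TwoRateWindowScheme):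
(U, UV, group-blind, no existential) for every compact G, faithful r, scheme sch at weak coupling
with polynomial volumes, PAST-SUPPORTED bump u (tsupport u ⊆ {y | y 0 < 0} — W₂'s clause; the
hypothesis blocks of U_R and W₂ are character-identical), p, M with the floor a_k^p ≤ T⁰_k(u,θu) and
the window T⁰_k(u,θu) ≤ M·T⁰_k(τ₋₁u,θτ₋₁u) of W₁ at u: the plane-resolved smeared plaquette fields
of the SELF-NORMALISED scheme `canon` (c'_k := 1/√T⁰_k(u,θu), m'_k := the torus expectation of the
action density; a, β, L unchanged) obey `UniformMomentBoundsPlanes r canon` (inlined, Iff.rfl):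
|∫∏ᵢΦ(Fᵢ)dμ_k| ≤ C₀C₁ⁿn! for all n, all k, all normalised pairwise plane-wise disjoint tuples. With
past support τ₋₁u is an honest reflected pair two time-units further apart, so the window caps the
physical mass (spectral log-convexity propagates the one-step window to all translates) and the
perverse collapsing-window two-rate schemes behind the negative lemma (u = τ₊₁w, w straddling x⁰ -/
@[route_item "route-QuantumFields-ScalingWindowSplit", crux]
def SelfNormalisedMomentBoundsR : Prop :=
  open Literature.MathematicalPhysics.QuantumLattice Literature.MathematicalPhysics.AQFT Literature.MathematicalPhysics.QuantumFieldTheory in let E := EuclideanSpace ℝ (Fin 4); ∀ (G : Type) [Group G] [TopologicalSpace G] [IsTopologicalGroup G] [CompactSpace G] [MeasurableSpace G] [BorelSpace G] (r : LatticeRep G) (sch : SpeciesScheme (YMSpecies G)) (u : SchwartzMap E ℝ) (p : ℕ) (M : ℝ), let bare : SpeciesScheme (YMSpecies G) := { sch with c := fun _ _ => 1, m := fun _ _ => 0 }; let T : SchwartzMap E ℝ → ℕ → ℝ := fun w k => latticeSchwinger r.ρ bare (fun s => s.F) k (1 + 1) (fun _ => r.curvature) ![w, thetaTest 4 w] - latticeSchwinger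 r.ρ bare (fun s => s.F) k 1 (fun _ => r.curvature) ![w] * latticeSchwinger r.ρ bare (fun s => s.F) k 1 (fun _ => r.curvature) ![thetaTest 4 w]; let canon : SpeciesScheme (YMSpecies G) := { sch with c := fun _ k => (Real.sqrt (T u k))⁻¹, m := fun _ k => ∫ U, r.curvature.F (torusLift (sch.side k) U) ∂(wilsonMeasure r.ρ (sch.β k)) }; sch.HasWeakCouplingLimit → (∃ N : ℕ, 1 ≤ N ∧ ∀ᶠ k in Filter.atTop, (sch.a k)⁻¹ ≤ (sch.a k * (sch.L k : ℝ)) ^ N) → tsupport u ⊆ {y : E | y 0 < 0} → (∀ᶠ k in Filter.atTop, (sch.a k) ^ p ≤ T u k ∧ T u k ≤ M * T (timeShiftTest 4 (-1) u) k) → ∃ (s : ℕ) (C₀ C₁ : ℝ), ∀ (n : ℕ) (F : Fin n → {q : Fin 4 × Fin 4 // q.1 < q.2} → SchwartzMap E ℝ), (∀ i, ∑ q, schwartzNorm s (ofRealTest (F i q)) ≤ 1) → (∀ i j, i ≠ j → ∀ q q', Disjoint (tsupport (F i q)) (tsupport (F j q'))) → ∀ k : ℕ, |∫ U, ∏ i,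 ∑ q : {q : Fin 4 × Fin 4 // q.1 < q.2}, smearedLatticeField (plaquetteObs r.ρ 0 q.1.1 q.1.2) (Literature.Probability.LatticeModels.box 4 (canon.L k)) (canon.a k) (canon.c r.curvature k) (canon.m r.curvature k / 6) (F i q) (torusLift (canon.side k) U) ∂(wilsonMeasure r.ρ (canon.β k) : Measure (GaugeConfig 4 (canon.side k) G))| ≤ C₀ * C₁ ^ n * n.factorial

/-- item stmt-QuantumFields-16192 · crux · rank 4 · open · by planner
why it might fail: Non-perturbative (a/ℓ)² irrelevance of the W(B₄)-scalar dim-6 O(4)-breaking operators (Weisz1983) along weak-coupling Wilson schemes is unproved — no small parameter but (a/ℓ)²; the guards alone never force Σ5-blindness (e1-counterexample-zoo).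
sources: Symanzik1983, Weisz1983, LuscherWeisz1985, LangRebbi1982, DavoudiSavage2012, DKKMO2020Rotational
[crux] card K1 in continuum form (ORIENTATION AMNESIA; re-typed 2026-08-16 with the weak-coupling
hypothesis of the revised statement p116790): for every compact simple G, every faithful lattice
representation r, every sequential scheme sch AT WEAK COUPLING (sch.HasWeakCouplingLimit: β_k =
2/g₀² → ∞) and every labelled Schwinger family S on ℝ⁴ that has E0, E0', E2, E3, E4, translation and
proper-hypercubic invariance on ⁰𝒮, IS the joint limit of the renormalised Wilson lattice
correlations along sch (the body of IsYangMillsFor), is non-trivial in the curvature species and has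
a continuum and a uniform lattice mass gap Δ > 0, the Schwinger functions of the curvature species
tr F² (every arity, on ⁰𝒮) are invariant under the Σ5 rotation R (R e₀ = e₀, R e₁ = e₁, R e₂ =
(3e₂+4e₃)/5, R e₃ = (−4e₂+3e₃)/5). Intended engine (layer 2): one-step commensurate self-comparison
on Λ = (2+i)ℤ[i]×ℤ² — the Λ-blocked law of μ_k and its image under the Λ-symmetry g = R_θ∘σ₃ (which
swaps ℤ⁴ and R_θℤ⁴) agree asymptotically on Λ-local gauge-invariant observables at physical
separation. [difficulty: open-problem] -/
@[route_item "route-QuantumFields-ScalingWindowSplit", crux]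
def CurvatureAmnesia : Prop :=
  open Literature.MathematicalPhysics.QuantumLattice Literature.MathematicalPhysics.AQFT Literature.MathematicalPhysics.QuantumFieldTheory in let E := EuclideanSpace ℝ (Fin 4); ∀ (G : Type) [Group G] [TopologicalSpace G] [IsTopologicalGroup G] [CompactSpace G], IsCompactSimpleLieGroup G → letI : MeasurableSpace G := borel G; haveI : BorelSpace G := ⟨rfl⟩; ∀ (r : LatticeRep G) (sch : SpeciesScheme (YMSpecies G)) (S : LabelledSchwingerFamily (YMSpecies G) (E)), sch.HasWeakCouplingLimit → (S.IsNormalized ∧ S.IsHermitian ∧ S.HasLinearGrowth ∧ S.IsReflectionPositive ∧ S.IsSymmetric ∧ S.HasClusterProperty ∧ (∀ (n : ℕ) (k : Fin n → YMSpecies G) (a : E) (F : SchwartzMap (Fin n → E) ℂ), IsOffDiagonal F → S n k (translateMulti a F) = S n k F) ∧ (∀ (n : ℕ) (k : Fin n → YMSpecies G) (R : E ≃ₗᵢ[ℝ] E), LinearMap.det (R.toLinearEquiv : E →ₗ[ℝ] E) = 1 → (∀ i : Fin 4, ∃ j : Fin 4, R (EuclideanSpace.single i 1) = EuclideanSpace.single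 j 1 ∨ R (EuclideanSpace.single i 1) = -EuclideanSpace.single j 1) → ∀ F : SchwartzMap (Fin n → E) ℂ, IsOffDiagonal F → S n k (linActMulti R F) = S n k F)) → (∀ (n : ℕ), n ≠ 0 → ∀ (σ : Fin n → YMSpecies G) (f : Fin n → SchwartzMap (E) ℝ) (F : SchwartzMap (Fin n → E) ℂ), IsTensorOf F (fun i => ofRealTest (f i)) → IsOffDiagonal F → Filter.Tendsto (fun k : ℕ => ((latticeSchwinger r.ρ sch (fun s => s.F) k n σ f : ℝ) : ℂ)) Filter.atTop (nhds (S n σ F))) → (∃ (F₁ G₁ : SchwartzMap (Fin 1 → E) ℂ) (H₁ : SchwartzMap (Fin (1 + 1) → E) ℂ), IsTimeOrdered F₁ ∧ IsTimeOrdered G₁ ∧ IsAppendTensorOf H₁ (osAdjoint F₁) G₁ ∧ S (1 + 1) (fun _ => r.curvature) H₁ ≠ S 1 (fun _ => r.curvature) (osAdjoint F₁) * S 1 (fun _ => r.curvature) G₁) → (∃ Δ : ℝ, 0 < Δ ∧ S.HasMassGap Δ ∧ HasLatticeMassGap r sch Δ) → (∀ (R : E ≃ₗᵢ[ℝ] E),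 (R (EuclideanSpace.single 0 1) = EuclideanSpace.single 0 1 ∧ R (EuclideanSpace.single 1 1) = EuclideanSpace.single 1 1 ∧ R (EuclideanSpace.single 2 1) = (3/5 : ℝ) • EuclideanSpace.single 2 1 + (4/5 : ℝ) • EuclideanSpace.single 3 1 ∧ R (EuclideanSpace.single 3 1) = -((4/5 : ℝ) • EuclideanSpace.single 2 1) + (3/5 : ℝ) • EuclideanSpace.single 3 1) → ∀ (n : ℕ) (F : SchwartzMap (Fin n → E) ℂ), IsOffDiagonal F → S n (fun _ => r.curvature) (linActMulti R F) = S n (fun _ => r.curvature) F)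

/-- item stmt-QuantumFields-18170 · crux · rank 5 · open · by planner
why it might fail: Leading order is ZERO (treeLevelSkewness_vanishes): nothing perturbative supports it; a gapped one-scale limit whose tr F² has vanishing separated-point 3-point function (φ⁴₄-type fate, AizenmanDuminilCopin2021), or no single disjoint triple serving every subsequential limit, breaks it.
sources: AizenmanDuminilCopin2021, Chatterjee2026YMHiggs, Michael1987, MontvayMunster1994, GlimmJaffe1987, JaffeWitten2000
[crux] (W₂ᴳ, non-triviality at ONE scale, group-blind; rev 8 REPAIR of SelfNormalisedSkewness =
stmt-QuantumFields-18944, REFUTED-MISSTATED by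
Theorems.SelfNormalisedSkewness.Negative.not_SelfNormalisedSkewness — along the super-weak U(1)₄
window scheme all four hypotheses hold while the self-normalised κ₃ of tr F² tends to its
free-Maxwell value 0, the tree-level skewness of F_μνF_μν vanishing identically in d = 4
(treeLevelSkewness_vanishes, maxwellOddRing_eq_zero); this is the refuter's repaired statement C′,
`Repaired.lean` on stmt-18944, against which the crux ideas running-gap-sum-rule /
hellmann-feynman-slab / trace-anomaly-ope are typed) for every compact G, faithful r, scheme sch AT
WEAK COUPLING, past-supported bump u, p, M and Δ > 0 WITH the volume-uniform lattice mass gap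
`HasLatticeMassGap r sch Δ` (W₁'s clause; inserted right after `sch.HasWeakCouplingLimit →`),
polynomial volumes, and eventually the floor a_k^p ≤ T⁰_k(u,θu) and the window T⁰_k(u,θu) ≤
M·T⁰_k(τ₋₁u,θτ₋₁u) of the BARE truncated plaquette two-point function: there are pairwise disjointly
supported real tests f, g, h and δ > 0 such that eventually the third cumulant of the
SELF-NORMALISED curvature field -/
@[route_item "route-QuantumFields-ScalingWindowSplit", crux]
def SelfNormalisedSkewnessGapped : Prop :=
  open Literature.MathematicalPhysics.QuantumLattice Literature.MathematicalPhysics.AQFT Literature.MathematicalPhysics.QuantumFieldTheory in let E := EuclideanSpace ℝ (Fin 4); ∀ (G : Type) [Group G] [TopologicalSpace G] [IsTopologicalGroup G] [CompactSpace G] [MeasurableSpace G] [BorelSpace G] (r : LatticeRep G) (sch : SpeciesScheme (YMSpecies G)) (u : SchwartzMap E ℝ) (p : ℕ) (M Δ : ℝ), let bare : SpeciesScheme (YMSpecies G) := { sch with c := fun _ _ => 1, m := fun _ _ => 0 }; let T : SchwartzMap E ℝ → ℕ → ℝ := fun w k => latticeSchwinger r.ρ bare (fun s => s.F) k (1 +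 1) (fun _ => r.curvature) ![w, thetaTest 4 w] - latticeSchwinger r.ρ bare (fun s => s.F) k 1 (fun _ => r.curvature) ![w] * latticeSchwinger r.ρ bare (fun s => s.F) k 1 (fun _ => r.curvature) ![thetaTest 4 w]; let canon : SpeciesScheme (YMSpecies G) := { sch with c := fun _ k => (Real.sqrt (T u k))⁻¹, m := fun _ k => ∫ U, r.curvature.F (torusLift (sch.side k) U) ∂(wilsonMeasure r.ρ (sch.β k)) }; sch.HasWeakCouplingLimit → 0 < Δ → HasLatticeMassGap r sch Δ → (∃ N : ℕ, 1 ≤ N ∧ ∀ᶠ k in Filter.atTop, (sch.a k)⁻¹ ≤ (sch.a k * (sch.L k : ℝ)) ^ N) → tsupport u ⊆ {y : E | y 0 < 0} → (∀ᶠ k in Filter.atTop, (sch.a k) ^ p ≤ T u k ∧ T u k ≤ M * T (timeShiftTest 4 (-1) u) k) → ∃ (f g h : SchwartzMap E ℝ) (δ : ℝ), Disjoint (tsupport f) (tsupport g) ∧ Disjoint (tsupport f) (tsupport h) ∧ Disjoint (tsupport g) (tsupport h) ∧ 0 < δ ∧ ∀ᶠ k in Filter.atTop, δ ≤ |latticeSchwinger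 r.ρ canon (fun s => s.F) k 3 (fun _ => r.curvature) ![f, g, h] - latticeSchwinger r.ρ canon (fun s => s.F) k 1 (fun _ => r.curvature) ![f] * latticeSchwinger r.ρ canon (fun s => s.F) k 2 (fun _ => r.curvature) ![g, h] - latticeSchwinger r.ρ canon (fun s => s.F) k 1 (fun _ => r.curvature) ![g] * latticeSchwinger r.ρ canon (fun s => s.F) k 2 (fun _ => r.curvature) ![f, h] - latticeSchwinger r.ρ canon (fun s => s.F) k 1 (fun _ => r.curvature) ![h] * latticeSchwinger r.ρ canon (fun s => s.F) k 2 (fun _ => r.curvature) ![f, g] + 2 * (latticeSchwinger r.ρ canon (fun s => s.F) k 1 (fun _ => r.curvature) ![f] * latticeSchwinger r.ρ canon (fun s => s.F) k 1 (fun _ => r.curvature) ![g] * latticeSchwinger r.ρ canon (fun s => s.F) k 1 (fun _ => r.curvature) ![h])|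

-- earlier SelfNormalisedMomentBounds (stmt-QuantumFields-18655, replaced 2026-08-17T03:07:48Z -> stmt-QuantumFields-18929): retired by None — open Literature.MathematicalPhysics.QuantumLattice Literature.MathematicalPhysics.AQFT Literature.MathematicalPhysics.QuantumFieldTheory Summit.QuantumFields.YangMills.Cruxes.HypercubicLimit.CouplingResponse in let E := EuclideanSpace ℝ (Fin 4); ∀ (G : Type) [
/-- item stmt-QuantumFields-18929 · support · rank 3 · open · by planner
why it might fail: k-uniform n!-bounds for composite insertions need Bałaban-type small/large-field control inside the correlation length, never completed for observables (the programme stops at the free energy); as typed ∀-schemes, one window scheme with an unbounded self-normalised 4-point function kills it.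
sources: Balaban1985, MagnenRivasseauSeneor1993, Guth1980, FrohlichSpencer1982
[crux] (U, UV, group-blind, no existential) for every compact G, faithful r, scheme sch at weak
coupling with polynomial volumes, bump u, p, M with the floor and the window of W₁ at u: the
plane-resolved smeared plaquette fields of the SELF-NORMALISED scheme `canon` (c'_k :=
1/√T⁰_k(u,θu), m'_k := the torus expectation of the action density; a, β, L unchanged) obey
`UniformMomentBoundsPlanes r canon`: |∫∏ᵢΦ(Fᵢ)dμ_k| ≤ C₀C₁ⁿn! for all n, all k, all normalised
pairwise plane-wise disjoint tuples. Contains the deep-UV (perturbative, a_kξ_k → ∞) schemes and the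
abelian Coulomb phase as genuine sub-cases. [difficulty: open-problem] CONE REPAIR rev 1
(2026-08-17): `PolyVolume sch` and the conclusion `UniformMomentBoundsPlanes r canon` (with
`fieldP`, `planeField`, `planeSpecies`, `normP`, `DisjP`, `wilsonAt`, `Plane` of
Theorems/MirrorModularBoostsHypercubicLimitCouplingResponseDefsC) are INLINED verbatim (`Iff.rfl` to
the rev-0 item stmt-QuantumFields-18655, certified in DefEq.lean); provers may rewrite back with
`show UniformMomentBoundsPlanes r canon` after importing DefsC. -/
@[route_item "route-QuantumFields-ScalingWindowSplit"]
def SelfNormalisedMomentBounds : Prop :=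
  open Literature.MathematicalPhysics.QuantumLattice Literature.MathematicalPhysics.AQFT Literature.MathematicalPhysics.QuantumFieldTheory in let E := EuclideanSpace ℝ (Fin 4); ∀ (G : Type) [Group G] [TopologicalSpace G] [IsTopologicalGroup G] [CompactSpace G] [MeasurableSpace G] [BorelSpace G] (r : LatticeRep G) (sch : SpeciesScheme (YMSpecies G)) (u : SchwartzMap E ℝ) (p : ℕ) (M : ℝ), let bare : SpeciesScheme (YMSpecies G) := { sch with c := fun _ _ => 1, m := fun _ _ => 0 }; let T : SchwartzMap E ℝ → ℕ → ℝ := fun w k => latticeSchwinger r.ρ bare (fun s => s.F) k (1 + 1) (fun _ => r.curvature) ![w, thetaTest 4 w] - latticeSchwinger r.ρ bare (fun s => s.F) k 1 (fun _ => r.curvature) ![w] * latticeSchwinger r.ρ bare (fun s => s.F) k 1 (fun _ => r.curvature) ![thetaTest 4 w]; let canon : SpeciesScheme (YMSpecies G) := { sch with c := fun _ k => (Real.sqrt (T u k))⁻¹, m := fun _ k => ∫ U, r.curvature.F (torusLift (sch.side k) U) ∂(wilsonMeasure r.ρ (sch.β k)) }; sch.HasWeakCouplingLimit → (∃ N : ℕ,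 1 ≤ N ∧ ∀ᶠ k in Filter.atTop, (sch.a k)⁻¹ ≤ (sch.a k * (sch.L k : ℝ)) ^ N) → (∀ᶠ k in Filter.atTop, (sch.a k) ^ p ≤ T u k ∧ T u k ≤ M * T (timeShiftTest 4 (-1) u) k) → ∃ (s : ℕ) (C₀ C₁ : ℝ), ∀ (n : ℕ) (F : Fin n → {q : Fin 4 × Fin 4 // q.1 < q.2} → SchwartzMap E ℝ), (∀ i, ∑ q, schwartzNorm s (ofRealTest (F i q)) ≤ 1) → (∀ i j, i ≠ j → ∀ q q', Disjoint (tsupport (F i q)) (tsupport (F j q'))) → ∀ k : ℕ, |∫ U, ∏ i, ∑ q : {q : Fin 4 × Fin 4 // q.1 < q.2}, smearedLatticeField (plaquetteObs r.ρ 0 q.1.1 q.1.2) (Literature.Probability.LatticeModels.box 4 (canon.L k)) (canon.a k) (canon.c r.curvature k) (canon.m r.curvature k / 6) (F i q) (torusLift (canon.side k) U) ∂(wilsonMeasure r.ρ (canon.β k) : Measure (GaugeConfig 4 (canon.side k) G))| ≤ C₀ * C₁ ^ n * n.factorial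

/-- item stmt-QuantumFields-18015 · aside · rank 9 · closed · proved by Summit.QuantumFields.YangMills.Theorems.ScalingWindowSplit.existenceLegFromLatticeR_proof @ 3d1b2604715d (prover) · by planner
sources: GlimmJaffe1987, OsterwalderSeiler1978
[support] THE TYPED SPLIT re-pointed at the repaired U (rev 6): GapAtCorrelationLength →
SelfNormalisedSkewness → SelfNormalisedMomentBoundsR → CoincidenceRotationBootstrap.HypercubicLimit,
BY NAME. PROVED sorry-free in the repair planner's LegCheck.lean (`existenceLegFromLatticeR_proof`:
`unfold`; `intro hW hS hU`; `hypercubicLimit_iff_oneFieldWeak.mpr`; W₁ at G gives ⟨r, sch, u, p, M,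
Δ, C, hw, hpv, hΔ, hgap, hrp, hu, hfw⟩; the landed seam
`Theorems.ScalingWindowSplit.oneField_of_latticeInequalities r sch u p M Δ C hw hpv hΔ hgap hrp hu
hfw (hU G r sch u p M hw hpv hu hfw) (hS G r sch u p M hw hpv hu hfw)` — i.e. the landed
`existenceLegFromLattice_proof` with ONE more token `hu`; lean check rc 0, 0 sorries, axioms
propext/Classical.choice/Quot.sound; attached as evidence). A prover lands it verbatim as
Summits/QuantumFields/YangMills/Theorems/ScalingWindowSplitExistenceLegFromLatticeR.lean importing
Theorems.ScalingWindowSplitExistenceLegFromLattice (heavy cone harmless in Theorems). It implies the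
rev-0 split ExistenceLegFromLattice (`existenceLegFromLattice_of_R`, Sketch.lean); `closes` takes it
as a binder. [deps: GapAtCorrelationLength, SelfNormalisedSkewness, SelfNormalised -/
@[route_item "route-QuantumFields-ScalingWindowSplit", crux]
def ExistenceLegFromLatticeR : Prop :=
  GapAtCorrelationLength → SelfNormalisedSkewness → SelfNormalisedMomentBoundsR → Summit.QuantumFields.YangMills.Theses.CoincidenceRotationBootstrap.HypercubicLimit

-- `ExistenceLegFromLatticeR` holds: proved by `Summit.QuantumFields.YangMills.Theorems.ScalingWindowSplit.existenceLegFromLatticeR_proof` @ 3d1b2604715d (its module imports this route file, so no `_holds` link can be stated here).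

/-- item stmt-QuantumFields-18171 · support · rank 9 · closed · proved by Summit.QuantumFields.YangMills.Theorems.ScalingWindowSplit.existenceLegFromLatticeGapped_proof @ 085a38a03231 (prover) · by planner
sources: GlimmJaffe1987, OsterwalderSeiler1978
[support] THE TYPED SPLIT re-pointed at the repaired W₂ᴳ (rev 8): GapAtCorrelationLength →
SelfNormalisedSkewnessGapped → SelfNormalisedMomentBoundsR →
CoincidenceRotationBootstrap.HypercubicLimit, BY NAME. PROVED sorry-free in the repair planner's
LegCheck2.lean (`existenceLegFromLatticeGapped_proof`: `unfold`; `intro hW hS hU`;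
`hypercubicLimit_iff_oneFieldWeak.mpr`; W₁ at G gives ⟨r, sch, u, p, M, Δ, C, hw, hpv, hΔ, hgap,
hrp, hu, hfw⟩; the landed seam `Theorems.ScalingWindowSplit.oneField_of_latticeInequalities r sch u
p M Δ C hw hpv hΔ hgap hrp hu hfw (hU G r sch u p M hw hpv hu hfw) (hS G r sch u p M Δ hw hΔ hgap
hpv hu hfw)` — i.e. the landed `existenceLegFromLatticeR_proof` with W₁'s gap also fed to W₂ᴳ; lean
check rc 0, 0 sorries, axioms propext/Classical.choice/Quot.sound; attached as evidence). A prover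
lands it verbatim as
Summits/QuantumFields/YangMills/Theorems/ScalingWindowSplitExistenceLegFromLatticeGapped.lean
importing Theorems.ScalingWindowSplitExistenceLegFromLattice (heavy cone harmless in Theorems). It
implies the rev-6 split ExistenceLegFromLatticeR (`existenceLegFromLatticeR_of_gapped`,
Sketch.lean); `closes` takes it as a binder. [deps: GapAtCorrelationLeng -/
@[route_item "route-QuantumFields-ScalingWindowSplit", crux]
def ExistenceLegFromLatticeGapped : Prop :=
  GapAtCorrelationLength → SelfNormalisedSkewnessGapped → SelfNormalisedMomentBoundsR → Summit.QuantumFields.YangMills.Theses.CoincidenceRotationBootstrap.HypercubicLimit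

-- `ExistenceLegFromLatticeGapped` holds: proved by `Summit.QuantumFields.YangMills.Theorems.ScalingWindowSplit.existenceLegFromLatticeGapped_proof` @ 085a38a03231 (its module imports this route file, so no `_holds` link can be stated here).

/-- item stmt-QuantumFields-18657 · support · rank 9 · closed · proved by Summit.QuantumFields.YangMills.Theorems.ScalingWindowSplit.existenceLegFromLattice_proof @ 83b1854ff93a (prover) · by planner
sources: GlimmJaffe1987, OsterwalderSeiler1978
[support] THE TYPED SPLIT (lens 3.4 deliverable): GapAtCorrelationLength → SelfNormalisedSkewness →
SelfNormalisedMomentBounds → CoincidenceRotationBootstrap.HypercubicLimit, BY NAME. PROVED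
sorry-free in the planner's Sketch.lean (`existenceLeg`, ~170 lines: the affine-renormalisation
covariance identity `cov_affine`, the self-normalisation identity T^canon_k(u,θu) = 1, `PolyRenorm`
from the floor, the bounded canonical counterterm, the tail sub-scheme, then the landed
`oneFieldClauses_of_uniformMomentBoundsPlanes` and `hypercubicLimit_iff_oneFieldWeak`); the same
proof is inlined in `closes`. A prover lands it verbatim so that MirrorModularBoosts /
PencilRigidity / CertificationLength / IsotropyFromPowerCounting can import the existence leg from
the three lattice items. [difficulty: provable-now] -/
@[route_item "route-QuantumFields-ScalingWindowSplit"]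
def ExistenceLegFromLattice : Prop :=
  GapAtCorrelationLength → SelfNormalisedSkewness → SelfNormalisedMomentBounds → Summit.QuantumFields.YangMills.Theses.CoincidenceRotationBootstrap.HypercubicLimit

-- `ExistenceLegFromLattice` holds: proved by `Summit.QuantumFields.YangMills.Theorems.ScalingWindowSplit.existenceLegFromLattice_proof` @ 83b1854ff93a (its module imports this route file, so no `_holds` link can be stated here).

/-- item stmt-QuantumFields-18949 · support · rank 9 · closed · proved by Summit.QuantumFields.YangMills.Theorems.ScalingWindowSplit.euclideanUpgrade_proof @ 3ddabc207c03 (prover) · by planner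
sources: DKKMO2020Rotational, OsterwalderSchrader1973, Niven1956
[support] (shared verbatim with CoincidenceRotationBootstrap, stmt-QuantumFields-8647 — ALREADY
PROVED by
Summit.QuantumFields.YangMills.Cruxes.OSLegsFromFemtoAndGap.DlrCollarTransfer.stub_upgrade) DENSITY
UPGRADE: for any label type ι and any labelled Schwinger family S on ℝ⁴, invariance on ⁰𝒮 under
every proper hypercubic isometry (det 1, permutes ±e_i) and under the Σ5 rotation R implies
invariance on ⁰𝒮 under every linear isometry of determinant 1. Taken as a binder of `closes` (as the
parent does) only so that the route file need not import the Theorems module of its landed proof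
(cone repair rev 4). [difficulty: provable-now — proved] -/
@[route_item "route-QuantumFields-ScalingWindowSplit", crux]
def EuclideanUpgrade : Prop :=
  open Literature.MathematicalPhysics.QuantumLattice Literature.MathematicalPhysics.AQFT Literature.MathematicalPhysics.QuantumFieldTheory in let E := EuclideanSpace ℝ (Fin 4); ∀ (ι : Type) (S : LabelledSchwingerFamily ι (E)), (∀ (n : ℕ) (k : Fin n → ι) (R : E ≃ₗᵢ[ℝ] E), LinearMap.det (R.toLinearEquiv : E →ₗ[ℝ] E) = 1 → (∀ i : Fin 4, ∃ j : Fin 4, R (EuclideanSpace.single i 1) = EuclideanSpace.single j 1 ∨ R (EuclideanSpace.single i 1) = -EuclideanSpace.single j 1) → ∀ F : SchwartzMap (Fin n → E) ℂ, IsOffDiagonal F → S n k (linActMulti R F) = S n k F) → (∀ (R : E ≃ₗᵢ[ℝ] E), (R (EuclideanSpace.single 0 1) = EuclideanSpace.single 0 1 ∧ R (EuclideanSpace.single 1 1) = EuclideanSpace.single 1 1 ∧ R (EuclideanSpace.single 2 1) = (3/5 : ℝ) • EuclideanSpace.single 2 1 + (4/5 : ℝ) • EuclideanSpace.single 3 1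 ∧ R (EuclideanSpace.single 3 1) = -((4/5 : ℝ) • EuclideanSpace.single 2 1) + (3/5 : ℝ) • EuclideanSpace.single 3 1) → ∀ (n : ℕ) (k : Fin n → ι) (F : SchwartzMap (Fin n → E) ℂ), IsOffDiagonal F → S n k (linActMulti R F) = S n k F) → ∀ (n : ℕ) (k : Fin n → ι) (R : E ≃ₗᵢ[ℝ] E), LinearMap.det (R.toLinearEquiv : E →ₗ[ℝ] E) = 1 → ∀ F : SchwartzMap (Fin n → E) ℂ, IsOffDiagonal F → S n k (linActMulti R F) = S n k F

-- `EuclideanUpgrade` holds: proved by `Summit.QuantumFields.YangMills.Theorems.ScalingWindowSplit.euclideanUpgrade_proof` @ 3ddabc207c03 (its module imports this route file, so no `_holds` link can be stated here).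

/-- item stmt-QuantumFields-18658 · assembly · rank 1 · closed · proved by Summit.QuantumFields.YangMills.Theorems.ScalingWindowSplit.assembly_proof @ 4a0757a57704 (prover) · by planner
sources: JaffeWitten2000, GlimmJaffe1987
[assembly] GapAtCorrelationLength → SelfNormalisedMomentBounds → CurvatureAmnesia →
SelfNormalisedSkewness → YangMills. -/
@[route_item "route-QuantumFields-ScalingWindowSplit"]
def Assembly : Prop :=
  GapAtCorrelationLength → SelfNormalisedMomentBounds → CurvatureAmnesia → SelfNormalisedSkewness → YangMills

-- `Assembly` holds: proved by `Summit.QuantumFields.YangMills.Theorems.ScalingWindowSplit.assembly_proof` @ 4a0757a57704 (its module imports this route file, so no `_holds` link can be stated here).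

-- records of items no longer active in this route (dropped / restated):
-- earlier SelfNormalisedSkewness (stmt-QuantumFields-18656, replaced 2026-08-17T03:08:10Z -> stmt-QuantumFields-18944): retired by None — open Literature.MathematicalPhysics.QuantumLattice Literature.MathematicalPhysics.AQFT Literature.MathematicalPhysics.QuantumFieldTheory Summit.QuantumFields.YangMills.Cruxes.HypercubicLimit.CouplingResponse in let E := EuclideanSpace ℝ (Fin 4); ∀ (G : Type) [Grou
-- earlier SelfNormalisedSkewness (stmt-QuantumFields-18944, dropped 2026-08-17T12:28:38Z): refuted by Summit.QuantumFields.YangMills.Theorems.SelfNormalisedSkewness.Negative.not_SelfNormalisedSkewness @ 9e633e60c564 — open Literature.MathematicalPhysics.QuantumLattice Literature.MathematicalPhysics.AQFT Literature.MathematicalPhysics.QuantumFieldTheory in let E := EuclideanSpace ℝ (Fin 4); ∀ (G : Ty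

/-! D-0027 §2.1 — DECIDING THEOREM (planner-authored via `route open/edit --closes-file`; by planner-rfix-QuantumFields-ScalingWindowSpli-58d14312-0 2026-08-17T12:24:33Z):
its hypotheses are this route's items and its conclusion the sub-problem Statement (glue_lint), and it elaborates with this file. -/

-- glue.lean — deciding theorem of route ScalingWindowSplit (D-0027 §2.1); rev 8 route-repair (planner-rfix-QuantumFields-ScalingWindowSpli-58d14312, 2026-08-17).
-- W₂ `SelfNormalisedSkewness` (stmt-QuantumFields-18944) was REFUTED-MISSTATED by `Theorems.SelfNormalisedSkewness.Negative.not_SelfNormalisedSkewness`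
-- (super-weak U(1) window scheme: every hypothesis holds, the self-normalised κ₃ of tr F² tends to its free-Maxwell value 0 — the tree-level
-- skewness of F_μνF_μν vanishes in d = 4, `treeLevelSkewness_vanishes`).  It is superseded by the GAPPED statement W₂ᴳ `SelfNormalisedSkewnessGapped`
-- (binder Δ; `0 < Δ → HasLatticeMassGap r sch Δ →` after `sch.HasWeakCouplingLimit →` — W₁'s own gap, which the Coulomb phase and the deep-UV schemes
-- miss), and the typed split is re-pointed: `ExistenceLegFromLatticeGapped : GapAtCorrelationLength → SelfNormalisedSkewnessGapped →
-- SelfNormalisedMomentBoundsR → CoincidenceRotationBootstrap.HypercubicLimit` (support, provable now: the landed `existenceLegFromLatticeR_proof` with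
-- W₁'s `Δ, hΔ, hgap` fed to W₂ᴳ — kernel-checked sorry-free in the planner's LegCheck2.lean).  Then, as before, the parent's
-- `CoincidenceRotationBootstrap.closes` with the shared crux `CurvatureAmnesia` (stmt-16192) and the shared PROVED support `EuclideanUpgrade` gives `YangMills`.
-- The refuted W₂, the held U `SelfNormalisedMomentBounds` and the proved splits `ExistenceLegFromLattice` / `ExistenceLegFromLatticeR` are asides, not binders.
-- Imports unchanged (parent route + EuclideanAction; needs-fact: none).  Every binder is load-bearing.
@[closes "route-QuantumFields-ScalingWindowSplit"] theorem closes (hW : GapAtCorrelationLength) (hU : SelfNormalisedMomentBoundsR) (hA : CurvatureAmnesia)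
    (hS : SelfNormalisedSkewnessGapped) (hLeg : ExistenceLegFromLatticeGapped) (hUpg : EuclideanUpgrade) : YangMills :=
  Summit.QuantumFields.YangMills.Theses.CoincidenceRotationBootstrap.closes hA (hLeg hW hS hU) hUpg

end Summit.QuantumFields.YangMills.Theses.ScalingWindowSplit
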